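import Summits.NavierStokesRegularity.NavierStokesRegularity.Theses.RellichScar
import Summits.NavierStokesRegularity.NavierStokesRegularity.Theorems.ScarRigidity.Negative.LogicAndLoadBearing
import Literature.Analysis.FluidPDE.TypeIAncientMild
import Literature.Analysis.FluidPDE.ParasiticSlabFlow
import Literature.Analysis.FluidPDE.LocalBiotSavartLog
import Literature.Analysis.FluidPDE.NewtonLocalPotential
import Literature.Analysis.FluidPDE.HarmonicBallMeanValue
import HarnessLib

/-!
# `ScarRigidity` — line `finite-energy-log-convexity`, stub `stub_apexDerivativeBounds`:
# an interior gradient estimate (crux stmt-NavierStokesRegularity-11717, route RellichScar)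

Helper file for S1β (elliptic tools for the pressure gradient). For the pressure `q` of a
classical solution only `∇q` is canonical; its size at a point is controlled by Green's
representation at a fixed scale (Gilbarg–Trudinger 2001, (2.16)–(2.17), in the tree's cut-off
form `f = N[Δf] + Λ[f]`, `NewtonLocalPotential.lean`):

* `abs_fderiv_apply_le_newton` — **interior gradient estimate**: for every radius `r₁ > 0` there
  are `A, B` with `|∂ₐf(y)| ≤ ‖a‖ (A sup_{B(y,3r₁)} |Δf| + B ∫_{B̄(y,r₁)} |f|)` for all
  `f ∈ C³(ℝ³)` (the near potential differentiated on the kernel,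
  `fderiv_newtonNearPotential_eq_newtonNearGradPotential`, `norm_newtonNearGradPotential_le`;
  the smoothing remainder differentiated on the smooth weight, as in
  `abs_fderiv_apply_le_of_laplacian_eq_zero`);
* `exists_divergence_convect_bound` — `|div((v·∇)v)(x)| ≤ T₀ (‖v‖‖D²v‖ + ‖Dv‖²)(x)`, the size of
  the source of the pressure Poisson equation `Δq = -div((v·∇)v)`;
* `le_of_ae_le_of_continuousOn` — an a.e. bound for a continuous function on an open set of
  times holds everywhere there.
-/

noncomputable section

open Set Filter Function MeasureTheory Metric TopologicalSpace
open scoped Topology ENNReal NNReal InnerProductSpace RealInnerProductSpace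
open Literature.Analysis.FluidPDE
open Summit.NavierStokesRegularity.NavierStokesRegularity.Theses.RellichScar
open Summit.NavierStokesRegularity.NavierStokesRegularity.Theorems.ScarRigidity.Negative

set_option linter.dupNamespace false

namespace Summit.NavierStokesRegularity.NavierStokesRegularity.Theorems.RellichScarScarRigidity

open Literature.Analysis
open scoped Laplacian

/-! ## An a.e. bound for a continuous function holds everywhere -/

/-- If `g` is continuous on an open set `I ⊆ ℝ` and `g ≤ K` a.e. on `I`, then `g ≤ K` on `I`
(an open set of positive measure cannot be null). [folklore] -/
theorem le_of_ae_le_of_continuousOn {g : ℝ → ℝ} {I : Set ℝ} (hI : IsOpen I) (hg : ContinuousOn g I)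
    {K : ℝ} (h : ∀ᵐ τ ∂(volume.restrict I), g τ ≤ K) : ∀ τ ∈ I, g τ ≤ K := by
  intro τ hτ
  by_contra hne
  rw [not_le] at hne
  set U : Set ℝ := I ∩ g ⁻¹' Ioi K with hU
  have hUopen : IsOpen U := hg.isOpen_inter_preimage hI isOpen_Ioi
  have hτU : τ ∈ U := ⟨hτ, hne⟩
  have hUpos : 0 < volume U := hUopen.measure_pos volume ⟨τ, hτU⟩
  have hUzero : volume U = 0 := by
    have h1 : ∀ᵐ s ∂(volume : Measure ℝ), s ∈ I → g s ≤ K := (ae_restrict_iff' hI.measurableSet).1 h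
    have h0 := ae_iff.1 h1
    refine measure_mono_null (fun s hs => ?_) h0
    intro himp
    have := himp hs.1
    exact absurd hs.2 (not_lt.2 this)
  exact absurd hUzero hUpos.ne'

/-! ## The size of the pressure source -/

/-- **The source of the pressure Poisson equation is quadratic in `(v, Dv, D²v)`**: there is an
absolute `T₀ ≥ 0` with `|div((v·∇)v)(x)| ≤ T₀ (‖Dv(x)‖² + ‖D²v(x)‖ ‖v(x)‖)` for every `C²` field
`v` on `ℝ³` (`div = tr ∘ D`, product rule for `x ↦ Dv(x)[v(x)]`). [folklore] -/
theorem exists_divergence_convect_bound :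
    ∃ T₀ : ℝ, 0 ≤ T₀ ∧ ∀ (v : (EuclideanSpace ℝ (Fin 3)) → (EuclideanSpace ℝ (Fin 3))) (x : (EuclideanSpace ℝ (Fin 3))), ContDiff ℝ 2 v →
      |VectorCalculus.divergence (convect v v) x| ≤
        T₀ * (‖fderiv ℝ v x‖ ^ 2 + ‖iteratedFDeriv ℝ 2 v x‖ * ‖v x‖) := by
  -- the trace functional on `ℝ³ →L ℝ³`
  set T : ((EuclideanSpace ℝ (Fin 3)) →L[ℝ] (EuclideanSpace ℝ (Fin 3))) →L[ℝ] ℝ :=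
    LinearMap.toContinuousLinearMap ((LinearMap.trace ℝ (EuclideanSpace ℝ (Fin 3))).comp (ContinuousLinearMap.coeLM ℝ)) with hT
  have hTapply : ∀ L : (EuclideanSpace ℝ (Fin 3)) →L[ℝ] (EuclideanSpace ℝ (Fin 3)), T L = LinearMap.trace ℝ (EuclideanSpace ℝ (Fin 3)) (L : (EuclideanSpace ℝ (Fin 3)) →ₗ[ℝ] (EuclideanSpace ℝ (Fin 3))) := fun L => rfl
  refine ⟨‖T‖, norm_nonneg T, fun v x hv => ?_⟩
  have hdiv : VectorCalculus.divergence (convect v v) x = T (fderiv ℝ (convect v v) x) := by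
    rw [hTapply]; rfl
  -- the derivative of `x ↦ Dv(x)[v(x)]`
  have hc : DifferentiableAt ℝ (fderiv ℝ v) x :=
    ((hv.fderiv_right (m := 1) le_rfl).differentiable (by norm_num)) x
  have hu : DifferentiableAt ℝ v x := (hv.differentiable (by norm_num)) x
  have hconv : convect v v = fun y => (fderiv ℝ v y) (v y) := by
    funext y; rfl
  have hD : fderiv ℝ (convect v v) x =
      (fderiv ℝ v x).comp (fderiv ℝ v x) + (fderiv ℝ (fderiv ℝ v) x).flip (v x) := by
    rw [hconv, fderiv_clm_apply hc hu]
  have h2 : ‖fderiv ℝ (fderiv ℝ v) x‖ = ‖iteratedFDeriv ℝ 2 v x‖ := by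
    rw [← norm_iteratedFDeriv_fderiv, norm_iteratedFDeriv_one]
  have hnorm : ‖fderiv ℝ (convect v v) x‖ ≤ ‖fderiv ℝ v x‖ ^ 2 + ‖iteratedFDeriv ℝ 2 v x‖ * ‖v x‖ := by
    rw [hD]
    refine (norm_add_le _ _).trans (add_le_add ?_ ?_)
    · rw [sq]; exact ContinuousLinearMap.opNorm_comp_le _ _
    · rw [← h2]
      calc ‖(fderiv ℝ (fderiv ℝ v) x).flip (v x)‖ ≤ ‖(fderiv ℝ (fderiv ℝ v) x).flip‖ * ‖v x‖ :=
            ContinuousLinearMap.le_opNorm _ _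
        _ = ‖fderiv ℝ (fderiv ℝ v) x‖ * ‖v x‖ := by rw [ContinuousLinearMap.opNorm_flip]
  rw [hdiv, ← Real.norm_eq_abs]
  exact (T.le_opNorm _).trans (mul_le_mul_of_nonneg_left hnorm (norm_nonneg _))

/-! ## The interior gradient estimate -/

/-- The smoothing-remainder half of the gradient: for `f ∈ C¹(ℝ³)`,
`|∂ₐΛ[f](y)| ≤ ‖a‖ M ∫_{B̄(y,r₁)} |f|` with `M = sup ‖Dλ^{r₀,r₁}‖` (differentiate on `f`, integrate
by parts onto the smooth compactly supported weight `λ`). [cite: GilbargTrudinger2001, Thm 2.10] -/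
theorem abs_fderiv_newtonFarSmoothing_apply_le {r₀ r₁ : ℝ} (h₀ : 0 < r₀) (h₁ : r₀ < r₁)
    {f : (EuclideanSpace ℝ (Fin 3)) → ℝ} (hf : ContDiff ℝ 1 f) {M : ℝ}
    (hM : ∀ z : (EuclideanSpace ℝ (Fin 3)), ‖fderiv ℝ (newtonFarLaplacian r₀ r₁) z‖ ≤ M) (y a : (EuclideanSpace ℝ (Fin 3))) :
    |fderiv ℝ (newtonFarSmoothing r₀ r₁ f) y a| ≤ ‖a‖ * M * ∫ w in closedBall y r₁, |f w| := by
  have hM0 : 0 ≤ M := (norm_nonneg _).trans (hM 0)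
  rw [fderiv_newtonFarSmoothing_apply h₀ h₁ hf y a, newtonFarSmoothing_apply,
    ← integral_fderiv_mul_comp_sub (contDiff_newtonFarLaplacian h₀ h₁)
      (hasCompactSupport_newtonFarLaplacian h₀.le h₁) hf y a]
  -- change variables `w = y - z`
  have hcv : ∫ z, fderiv ℝ (newtonFarLaplacian r₀ r₁) z a * f (y - z) =
      ∫ w, fderiv ℝ (newtonFarLaplacian r₀ r₁) (y - w) a * f w := by
    rw [← integral_sub_left_eq_self (fun z => fderiv ℝ (newtonFarLaplacian r₀ r₁) z a * f (y - z))
      volume y]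
    refine integral_congr_ae (Eventually.of_forall fun w => ?_)
    simp only [sub_sub_cancel]
  rw [hcv]
  have hdom : ∀ w, ‖fderiv ℝ (newtonFarLaplacian r₀ r₁) (y - w) a * f w‖ ≤
      (closedBall y r₁).indicator (fun w => ‖a‖ * M * |f w|) w := by
    intro w
    by_cases hw : w ∈ closedBall y r₁
    · rw [indicator_of_mem hw, norm_mul, Real.norm_eq_abs, Real.norm_eq_abs]
      gcongr
      calc |fderiv ℝ (newtonFarLaplacian r₀ r₁) (y - w) a|
          ≤ ‖fderiv ℝ (newtonFarLaplacian r₀ r₁) (y - w)‖ * ‖a‖ := by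
            rw [← Real.norm_eq_abs]; exact ContinuousLinearMap.le_opNorm _ _
        _ ≤ M * ‖a‖ := by gcongr; exact hM _
        _ = ‖a‖ * M := mul_comm _ _
    · rw [indicator_of_notMem hw]
      have hw' : r₁ < ‖y - w‖ := by
        rw [mem_closedBall, dist_eq_norm, not_le, ← norm_neg, neg_sub] at hw
        exact hw
      have : fderiv ℝ (newtonFarLaplacian r₀ r₁) (y - w) = 0 := by
        refine fderiv_of_notMem_tsupport ℝ fun hmem => ?_
        have := tsupport_newtonFarLaplacian_subset h₀.le h₁ hmem
        rw [mem_closedBall_zero_iff] at this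
        linarith
      rw [this, _root_.zero_apply, zero_mul, norm_zero]
  have hfi : IntegrableOn (fun w => |f w|) (closedBall y r₁) :=
    (hf.continuous.abs.continuousOn).integrableOn_compact (isCompact_closedBall y r₁)
  calc |∫ w, fderiv ℝ (newtonFarLaplacian r₀ r₁) (y - w) a * f w|
      ≤ ∫ w, ‖fderiv ℝ (newtonFarLaplacian r₀ r₁) (y - w) a * f w‖ := by
        rw [← Real.norm_eq_abs]; exact norm_integral_le_integral_norm _
    _ ≤ ∫ w, (closedBall y r₁).indicator (fun w => ‖a‖ * M * |f w|) w := by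
        refine integral_mono_of_nonneg (Eventually.of_forall fun w => norm_nonneg _) ?_
          (Eventually.of_forall hdom)
        exact IntegrableOn.integrable_indicator
          (show IntegrableOn (fun w => ‖a‖ * M * |f w|) (closedBall y r₁) volume from
            hfi.const_mul (‖a‖ * M)) measurableSet_closedBall
    _ = ‖a‖ * M * ∫ w in closedBall y r₁, |f w| := by
        rw [integral_indicator measurableSet_closedBall, integral_const_mul]

/-- **Interior gradient estimate through Green's representation at a fixed scale**
(Gilbarg–Trudinger 2001, (2.17) with Thm 2.10): for every `r₁ > 0` there are `A, B ≥ 0` such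
that for all `f ∈ C³(ℝ³)`, all `y`, `a` and every bound `G` of `|Δf|` on `B(y, 3r₁)`,
`|∂ₐf(y)| ≤ ‖a‖ (A G + B ∫_{B̄(y,r₁)} |f|)`. Proof: `f = N[Δf] + Λ[f]`
(`eq_newtonNearPotential_laplacian_add`); near `y` the truncated potential `N[Δf]` only sees
`Δf` on `B(y, 2r₁)`, where it agrees with the compactly supported `χ Δf`, and
`∂ₐN[χΔf] = T⁰ₐ[χΔf]` is bounded by `sup |χΔf|` (`norm_newtonNearGradPotential_le`); the
remainder is `abs_fderiv_newtonFarSmoothing_apply_le`. [cite: GilbargTrudinger2001, (2.16)–(2.17) and Thm 2.10] -/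
theorem abs_fderiv_apply_le_newton {r₁ : ℝ} (hr₁ : 0 < r₁) :
    ∃ A B : ℝ, 0 ≤ A ∧ 0 ≤ B ∧ ∀ (f : (EuclideanSpace ℝ (Fin 3)) → ℝ), ContDiff ℝ 3 f → ∀ (y : (EuclideanSpace ℝ (Fin 3))) (G : ℝ),
      (∀ w ∈ ball y (3 * r₁), |(Δ f) w| ≤ G) → ∀ a : (EuclideanSpace ℝ (Fin 3)),
        |fderiv ℝ f y a| ≤ ‖a‖ * (A * G + B * ∫ w in closedBall y r₁, |f w|) := by
  set r₀ : ℝ := r₁ / 2 with hr₀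
  have h₀ : 0 < r₀ := by positivity
  have h₁ : r₀ < r₁ := by rw [hr₀]; linarith
  obtain ⟨M, hM0, hM⟩ := exists_bound_fderiv_newtonFarLaplacian h₀ h₁
  obtain ⟨C₁, hC₁0, hC₁⟩ := exists_abs_newtonNearGrad_le h₀ h₁
  set A : ℝ := C₁ * (3 * (volume : Measure (EuclideanSpace ℝ (Fin 3))).real (ball 0 1)) * r₁ with hA
  have hA0 : 0 ≤ A := by positivity
  refine ⟨A, M, hA0, hM0, fun f hf y G hG a => ?_⟩
  have hf2 : ContDiff ℝ 2 f := hf.of_le (by norm_num)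
  have hf1 : ContDiff ℝ 1 f := hf.of_le (by norm_num)
  have hG0 : 0 ≤ G := (abs_nonneg _).trans (hG y (mem_ball_self (by positivity)))
  -- the source and its cut-off
  set g : (EuclideanSpace ℝ (Fin 3)) → ℝ := Δ f with hg
  have hg1 : ContDiff ℝ 1 g := FluidPDE.contDiff_laplacian (n := 1) (by exact hf)
  set χ : (EuclideanSpace ℝ (Fin 3)) → ℝ := fun w => radialCutoff (2 * r₁) (3 * r₁) (w - y) with hχ
  have hχs : ContDiff ℝ 1 χ :=
    (radialCutoff_contDiff (2 * r₁) (3 * r₁)).comp (contDiff_id.sub contDiff_const)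
  have h23 : 2 * r₁ < 3 * r₁ := by linarith
  set gc : (EuclideanSpace ℝ (Fin 3)) → ℝ := fun w => χ w * g w with hgc
  have hgc1 : ContDiff ℝ 1 gc := hχs.mul hg1
  have hgcsupp : HasCompactSupport gc := by
    refine HasCompactSupport.intro (isCompact_closedBall y (3 * r₁)) fun w hw => ?_
    rw [mem_closedBall, dist_eq_norm, not_le] at hw
    show χ w * g w = 0
    rw [hχ]
    simp only
    rw [radialCutoff_eq_zero (by positivity) h23 hw.le, zero_mul]
  have hgcb : ∀ w, ‖gc w‖ ≤ G := by
    intro w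
    rw [Real.norm_eq_abs]
    show |χ w * g w| ≤ G
    by_cases hw : w ∈ ball y (3 * r₁)
    · rw [abs_mul]
      calc |χ w| * |g w| ≤ 1 * G :=
          mul_le_mul (abs_radialCutoff_le_one _ _ _) (hG w hw) (abs_nonneg _) zero_le_one
        _ = G := one_mul _
    · rw [mem_ball, dist_eq_norm, not_lt] at hw
      rw [hχ]
      simp only
      rw [radialCutoff_eq_zero (by positivity) h23 hw, zero_mul, abs_zero]
      exact hG0
  -- Green's representation `f = N[g] + Λ[f]`
  have hrep : f = fun x => newtonNearPotential r₀ r₁ g x + newtonFarSmoothing r₀ r₁ f x :=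
    funext fun x => eq_newtonNearPotential_laplacian_add h₀ h₁ hf2 x
  -- near `y` the truncated potential only sees `gc`
  have hloc : newtonNearPotential r₀ r₁ g =ᶠ[𝓝 y] newtonNearPotential r₀ r₁ gc := by
    filter_upwards [ball_mem_nhds y hr₁] with y' hy'
    rw [newtonNearPotential_apply, newtonNearPotential_apply]
    refine integral_congr_ae (Eventually.of_forall fun z => ?_)
    by_cases hz : r₁ ≤ ‖z‖
    · simp only [newtonNear_eq_zero (by positivity) h₁ hz, zero_mul]
    · rw [not_le] at hz
      have hin : ‖y' - z - y‖ ≤ 2 * r₁ := by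
        rw [mem_ball, dist_eq_norm] at hy'
        calc ‖y' - z - y‖ = ‖(y' - y) - z‖ := by abel_nf
          _ ≤ ‖y' - y‖ + ‖z‖ := norm_sub_le _ _
          _ ≤ 2 * r₁ := by linarith
      show newtonNear r₀ r₁ z * g (y' - z) = newtonNear r₀ r₁ z * (χ (y' - z) * g (y' - z))
      rw [hχ]
      simp only
      rw [radialCutoff_eq_one (by positivity) h23 hin, one_mul]
  have hDN : fderiv ℝ (newtonNearPotential r₀ r₁ g) y a = newtonNearGradPotential r₀ r₁ a gc y := by
    rw [hloc.fderiv_eq, fderiv_newtonNearPotential_eq_newtonNearGradPotential h₀ h₁ hgc1 hgcsupp y a]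
  have hN : |fderiv ℝ (newtonNearPotential r₀ r₁ g) y a| ≤ ‖a‖ * (A * G) := by
    rw [hDN, ← Real.norm_eq_abs]
    refine (norm_newtonNearGradPotential_le h₀ h₁ hC₁0 hC₁ a hG0 hgcb y).trans (le_of_eq ?_)
    rw [hA]; ring
  have hΛ := abs_fderiv_newtonFarSmoothing_apply_le h₀ h₁ hf1 hM y a
  -- differentiability of the two halves
  have hdN : DifferentiableAt ℝ (newtonNearPotential r₀ r₁ g) y :=
    ((contDiff_newtonNearPotential h₀.le h₁ 1 hg1).differentiable (by norm_num)) y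
  have hdΛ : DifferentiableAt ℝ (newtonFarSmoothing r₀ r₁ f) y :=
    ((contDiff_newtonFarSmoothing h₀ h₁ 1 hf1).differentiable (by norm_num)) y
  have hsum : fderiv ℝ f y a = fderiv ℝ (newtonNearPotential r₀ r₁ g) y a +
      fderiv ℝ (newtonFarSmoothing r₀ r₁ f) y a := by
    conv_lhs => rw [hrep]
    rw [fderiv_fun_add hdN hdΛ, _root_.add_apply]
  rw [hsum]
  calc |fderiv ℝ (newtonNearPotential r₀ r₁ g) y a + fderiv ℝ (newtonFarSmoothing r₀ r₁ f) y a|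
      ≤ |fderiv ℝ (newtonNearPotential r₀ r₁ g) y a| + |fderiv ℝ (newtonFarSmoothing r₀ r₁ f) y a| :=
        abs_add_le _ _
    _ ≤ ‖a‖ * (A * G) + ‖a‖ * M * ∫ w in closedBall y r₁, |f w| := add_le_add hN hΛ
    _ = ‖a‖ * (A * G + M * ∫ w in closedBall y r₁, |f w|) := by ring

/-! ## Registered sub-goal (helper stub of `stub_apexDerivativeBounds`) -/

/-- **Registered helper stub `stub_apexInteriorGradient`** (sub-goal of `stub_apexDerivativeBounds`,
crux stmt-NavierStokesRegularity-11717): the interior gradient estimate through Green's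
representation at a fixed scale, `|∂ₐf(y)| ≤ ‖a‖ (A sup_{B(y,3r₁)} |Δf| + B ∫_{B̄(y,r₁)} |f|)`.
[cite: GilbargTrudinger2001, (2.16)–(2.17) and Thm 2.10] -/
theorem stub_apexInteriorGradient :
    ∀ r₁ : ℝ, 0 < r₁ → ∃ A B : ℝ, 0 ≤ A ∧ 0 ≤ B ∧ ∀ (f : EuclideanSpace ℝ (Fin 3) → ℝ), ContDiff ℝ 3 f →
      ∀ (y : EuclideanSpace ℝ (Fin 3)) (G : ℝ),
        (∀ w ∈ Metric.ball y (3 * r₁), |Laplacian.laplacian f w| ≤ G) →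
        ∀ a : EuclideanSpace ℝ (Fin 3),
          |fderiv ℝ f y a| ≤ ‖a‖ * (A * G + B * ∫ w in Metric.closedBall y r₁, |f w|) :=
  fun _ hr₁ => abs_fderiv_apply_le_newton hr₁

end Summit.NavierStokesRegularity.NavierStokesRegularity.Theorems.RellichScarScarRigidity

end
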